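import Summits.CriticalPhenomena.PercolationContinuityZ3.Theorems.PercNearOneGluingNoHeavyLowerTailSahiCombTensorisation
import Summits.CriticalPhenomena.PercolationContinuityZ3.Theorems.PercNearOneGluingNoHeavyLowerTailSahiCombCylinder
import Summits.CriticalPhenomena.PercolationContinuityZ3.Theorems.PercNearOneGluingNoHeavyLowerTailSahiC3CombCube

/-!
# The comb (tensor-Bernstein) hierarchy for Sahi's `E_k`, XII: comb positivity is closed under READ-ONCE MONOTONE SUBSTITUTION (every `k`)

Support file of the one-cut programme (crux `NoHeavyLowerTail`, stmt-CriticalPhenomena-4575; cell `prim-masterthm`, seat P3, gen 3;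
`run/shared/lean/prim/prim-masterthm/prim-masterthm-p3/HIERARCHY.md` §10).  Vocabulary: `SahiComb.CombPos`, `MasterFamilyCombPos k` (`…SahiCombPositivity`,
`…SahiCombMasterFamily`), the kill push-forward / ignored-coordinate lemmas of `…SahiCombTensorisation`.

SETTING.  `π : ι → κ` assigns every fresh coordinate to a base coordinate; gadgets `G e ⊆ 2^ι` (`e : κ`) are events determined by the fibre `{i | π i = e}`
(so the `G e` are independent under every product measure `μ_q`); the READ-ONCE SUBSTITUTION of the gadgets into an event `U ⊆ 2^κ` is
`U∘G := {ω | {e | ω ∈ G e} ∈ U}` (increasing if `U` and the gadgets are).  Under `μ_q` the vector `(1_{G e})_e` is a vector of independent Bernoulli variables with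
parameters `c_e(q) = μ_q(G e)`:
* `pushWeight_readOnce` — the image of `μ_q` under `ω ↦ {e | ω ∈ G e}` is the product weight with parameters `c(q)` (iterated independence over the disjoint fibres,
  `prodBernoulli_real_inter_biInter_of_determinedBy`); hence `sahiE_readOnce_eq`: `E_k(μ_q; 1_{U∘G}) = E_k(μ_{c(q)}; 1_U)` — the law-level transfer (trivial);
* **`CombPos.readOnce`** — THE COMB-LEVEL TRANSFER: if `p ↦ E_k(μ_p; 1_U)` is comb-positive at multidegree `k` on `[0,1]^κ`, then `q ↦ E_k(μ_q; 1_{U∘G})` is comb-positive at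
  multidegree `k` on `[0,1]^ι`.  Proof: substitute `p_e = c_e(q)` in a nonnegative Bernstein representation; `c_e` and `1 − c_e` are comb-positive of multidegree `1` supported on
  the fibre of `e` (`combPos_ex_ind` + `SahiComb.CombPos.of_ignores_finset`), so `∏_e c_e^{j_e}(1−c_e)^{k−j_e}` is comb-positive of multidegree `Σ_e k·1_{fibre e} = k`
  (`SahiComb.CombPos.pow/prod`).  So (M⁺-k) is a statement about read-once-irreducible families, and every comb theorem on a cube transfers to the monotone algebra generated by
  independent increasing events of any cube (bnk-1's `…CombSubstitution` is the series/parallel case at `k = 3`; l12-p3's sub-cube transport `CombPos.comp_restr` is the case of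
  identity gadgets);
* UNCONDITIONAL COROLLARIES (every product measure, every finite cube, gadgets `G e` increasing and independent): `combPos_sahiE_ind_monomials` — **for every `n`, `E_n` of any
  family of INTERSECTIONS `⋂_{e ∈ S_j} G e` is comb-positive** (comb form of Sahi's Theorem 2 with coordinates replaced by independent increasing events; from
  `combPos_sahiE_ind_of_cylinders`); `combPos_sahiE_ind_readOnce_offTwo` — the same with up to two members arbitrary increasing events of the algebra generated by the gadgets
  (from `combPos_sahiE_ind_of_allButTwoCylinders`); `combPos_sahiE_three_readOnce_three` — **(M⁺-3) for every triple of increasing events in the monotone algebra generated by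
  THREE independent increasing events** (from the kernel certificate `SahiC3CombCube.combPos_sahiE_three_of_card_le_three`); `masterFamilyCombPos_readOnce` — (M⁺-k) ⇒ its own
  read-once closure (bookkeeping form).
HONEST FRAMING: nothing here asserts (M⁺-k) or `C_k` for `k ≥ 3`. [this work]
-/

noncomputable section

open scoped Classical

namespace Summit.CriticalPhenomena.PercolationContinuityZ3.Theorems

open Finset Function MeasureTheory
open Literature.Combinatorics.Sahi2008
open Literature.Probability.LatticeModels (prodBernoulli)
open Literature.Probability.Percolation (DeterminedBy determinedBy_iff determinedBy_univ)
open Literature.Probability.Percolation.DecisionTree (ind ind_of_mem ind_of_not_mem ind_nonneg)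
open Literature.Probability.Percolation.BHK2006 (weight)
open SahiComb SahiCombTensor

/-! ### Powers of certificates -/

/-- **Powers**: `F^n` is comb-positive at multidegree `n • c`. [this work] -/
theorem SahiComb.CombPos.pow {ι : Type*} [Fintype ι] {c : ι → ℕ} {F : (ι → unitInterval) → ℝ} (h : CombPos c F) :
    ∀ n : ℕ, CombPos (n • c) (fun p => F p ^ n)
  | 0 => by simpa using combPos_one (ι := ι) 0
  | n + 1 => by
    have h1 := (SahiComb.CombPos.pow h n).mul h
    rw [succ_nsmul]
    exact h1.congr fun p => by rw [pow_succ]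

namespace SahiCombReadOnce

variable {ι κ : Type} [Fintype ι] [Fintype κ]

/-! ### Read-once substitution: the law-level transfer -/

omit [Fintype ι] [Fintype κ] in
/-- The substituted event `U∘G = {ω | {e | ω ∈ G e} ∈ U}` is increasing when `U` and the gadgets are. [folklore] -/
theorem isUpperSet_readOnce {G : κ → Set (Set ι)} (hG : ∀ e, IsUpperSet (G e)) {U : Set (Set κ)} (hU : IsUpperSet U) :
    IsUpperSet {ω : Set ι | {e | ω ∈ G e} ∈ U} :=
  fun _ _ hle hω => hU (fun e he => hG e hle he) hω

omit [Fintype ι] [Fintype κ] in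
/-- Substitution into a cylinder gives the intersection of the gadgets: `{S ⊆ ·}∘G = ⋂_{e∈S} G e`. [folklore] -/
theorem readOnce_cylinder (G : κ → Set (Set ι)) (S : Set κ) :
    {ω : Set ι | {e | ω ∈ G e} ∈ {ξ : Set κ | S ⊆ ξ}} = ⋂ e ∈ S, G e := by
  ext ω; simp only [Set.mem_setOf_eq, Set.mem_iInter]; rfl

omit [Fintype κ] in
/-- The fibre of `π` over `e`, as a finset. [folklore] -/
theorem coe_fibre (π : ι → κ) (e : κ) : (↑(univ.filter fun i => π i = e) : Set ι) = {i | π i = e} := by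
  ext i; simp

/-- **The image of `μ_q` under `ω ↦ {e | ω ∈ G e}` is the product weight with parameters `μ_q(G e)`** (gadgets determined by the disjoint fibres of
`π`, hence independent). [this work] -/
theorem pushWeight_readOnce (π : ι → κ) (G : κ → Set (Set ι)) (hG : ∀ e, DeterminedBy (G e) {i | π i = e}) (q : ι → unitInterval) :
    pushWeight (bernoulliWeight q) (fun ω : Set ι => {e | ω ∈ G e}) = weight fun e => (prodBernoulli q).real (G e) := by
  funext ξ
  -- the fibre over `ξ` is the intersection of the independent events `C e = {ω | ω ∈ G e ↔ e ∈ ξ}`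
  set C : κ → Set (Set ι) := fun e => {ω : Set ι | ω ∈ G e ↔ e ∈ ξ} with hC
  have hfib : ∀ ω : Set ι, ({e | ω ∈ G e} = ξ) ↔ ω ∈ ⋂ e ∈ (univ : Finset κ), C e := fun ω => by
    simp only [Finset.mem_univ, Set.iInter_true, Set.mem_iInter, hC, Set.mem_setOf_eq, Set.ext_iff]
  have h1 : pushWeight (bernoulliWeight q) (fun ω : Set ι => {e | ω ∈ G e}) ξ =
      (prodBernoulli q).real (⋂ e ∈ (univ : Finset κ), C e) := by
    rw [pushWeight_apply, ← ex_bernoulliWeight_ind, ex_def]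
    refine sum_congr rfl fun ω _ => ?_
    by_cases hω : {e | ω ∈ G e} = ξ
    · rw [if_pos hω, ind_of_mem ((hfib ω).1 hω), mul_one]
    · rw [if_neg hω, ind_of_not_mem (fun h => hω ((hfib ω).2 h)), mul_zero]
  have hCdet : ∀ e, DeterminedBy (C e) (↑(univ.filter fun i => π i = e) : Set ι) := fun e => by
    rw [coe_fibre, determinedBy_iff]
    intro ω ω' hωω'
    simp only [hC, Set.mem_setOf_eq]
    rw [(determinedBy_iff _ _).1 (hG e) ω ω' hωω']
  have hdisj : ((univ : Finset κ) : Set κ).PairwiseDisjoint (fun e => univ.filter fun i => π i = e) := by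
    intro e _ e' _ hee'
    exact Finset.disjoint_filter.2 fun i _ hi hi' => hee' (hi.symm.trans hi')
  have h2 := Literature.Probability.LatticeModels.prodBernoulli_real_inter_biInter_of_determinedBy q univ
    (fun e => univ.filter fun i => π i = e) hdisj (C := C) (fun e _ => hCdet e) (fun e _ => MeasurableSet.of_discrete)
    (A := Set.univ) (determinedBy_univ _) MeasurableSet.univ
  rw [Set.univ_inter, probReal_univ, one_mul] at h2
  rw [h1, h2]
  unfold weight
  refine prod_congr rfl fun e _ => ?_
  by_cases he : e ∈ ξ
  · have : C e = G e := by ext ω; simp [hC, he]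
    rw [this, if_pos he]
  · have : C e = (G e)ᶜ := by ext ω; simp [hC, he]
    rw [this, if_neg he, measureReal_compl MeasurableSet.of_discrete, probReal_univ]

/-- **Law-level transfer**: `E_k(μ_q; 1_{U_0∘G},…) = E_k(μ_{c(q)}; 1_{U_0},…)` with `c_e(q) = μ_q(G e)`. [this work] -/
theorem sahiE_readOnce_eq (π : ι → κ) (G : κ → Set (Set ι)) (hG : ∀ e, DeterminedBy (G e) {i | π i = e}) (q : ι → unitInterval)
    {k : ℕ} (U : Fin k → Set (Set κ)) :
    sahiE (bernoulliWeight q) k (fun j => ind {ω : Set ι | {e | ω ∈ G e} ∈ U j}) =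
      sahiE (weight fun e => (prodBernoulli q).real (G e)) k (fun j => ind (U j)) := by
  rw [← pushWeight_readOnce π G hG q, sahiE_pushWeight]
  rfl

/-! ### The comb-level transfer -/

omit [Fintype κ] in
/-- The gadget probability `q ↦ μ_q(G e)` ignores the coordinates outside the fibre of `e`. [this work] -/
theorem real_gadget_update_eq (π : ι → κ) {G : κ → Set (Set ι)} (hG : ∀ e, DeterminedBy (G e) {i | π i = e}) (e : κ)
    (q : ι → unitInterval) {i : ι} (hi : π i ≠ e) (s : unitInterval) :
    (prodBernoulli (update q i s)).real (G e) = (prodBernoulli q).real (G e) := by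
  rw [← ex_bernoulliWeight_ind, ← ex_bernoulliWeight_ind]
  have hφ : ∀ (j : Fin 1) (ω : Set ι), (![ind (G e)] : Fin 1 → Set ι → ℝ) j ω = (![ind (G e)] : Fin 1 → Set ι → ℝ) j (ω \ {i | π i = e}ᶜ) := by
    intro j ω
    have h := ind_eq_ind_of_inter_eq (hG e) (ω := ω) (ω' := ω \ {i | π i = e}ᶜ)
      (by ext x; simp only [Set.mem_inter_iff, Set.mem_sdiff, Set.mem_compl_iff, not_not, Set.mem_setOf_eq]; tauto)
    fin_cases j
    exact h
  have h := sahiE_bernoulliWeight_update_eq_of_diff q {i | π i = e}ᶜ ![ind (G e)] hφ (by simpa using hi) s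
  simpa only [sahiE_one_apply, Matrix.cons_val_zero] using h

omit [Fintype κ] in
/-- `q ↦ μ_q(G e)` is comb-positive of multidegree `1` on the fibre of `e`, `0` elsewhere. [this work] -/
theorem combPos_real_gadget (π : ι → κ) {G : κ → Set (Set ι)} (hG : ∀ e, DeterminedBy (G e) {i | π i = e}) (e : κ) :
    CombPos (fun i => if i ∈ univ.filter (fun i => π i ≠ e) then 0 else 1) (fun q => (prodBernoulli q).real (G e)) := by
  refine ((combPos_ex_ind (G e)).congr fun q => (ex_bernoulliWeight_ind q (G e)).symm).of_ignores_finset _ fun i hi q s => ?_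
  exact real_gadget_update_eq π hG e q (Finset.mem_filter.1 hi).2 s

omit [Fintype κ] in
/-- `q ↦ 1 − μ_q(G e)` likewise. [this work] -/
theorem combPos_one_sub_real_gadget (π : ι → κ) {G : κ → Set (Set ι)} (hG : ∀ e, DeterminedBy (G e) {i | π i = e}) (e : κ) :
    CombPos (fun i => if i ∈ univ.filter (fun i => π i ≠ e) then 0 else 1) (fun q => 1 - (prodBernoulli q).real (G e)) := by
  refine ((combPos_one_sub_ex_ind (G e)).congr fun q => by rw [ex_bernoulliWeight_ind]).of_ignores_finset _ fun i hi q s => ?_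
  rw [real_gadget_update_eq π hG e q (Finset.mem_filter.1 hi).2 s]

/-- The substituted Bernstein basis function `∏_e c_e(q)^{j_e}(1 − c_e(q))^{k − j_e}` is comb-positive at multidegree `k`. [this work] -/
theorem combPos_bern_gadget (π : ι → κ) {G : κ → Set (Set ι)} (hG : ∀ e, DeterminedBy (G e) {i | π i = e}) (k : ℕ) {j : κ → ℕ}
    (hj : j ∈ box (fun _ : κ => k)) :
    CombPos (fun _ : ι => k) (fun q => ∏ e, ((prodBernoulli q).real (G e)) ^ (j e) * (1 - (prodBernoulli q).real (G e)) ^ (k - j e)) := by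
  set δ : κ → ι → ℕ := fun e i => if i ∈ univ.filter (fun i => π i ≠ e) then 0 else 1 with hδ
  have hterm : ∀ e, CombPos (j e • δ e + (k - j e) • δ e)
      (fun q => ((prodBernoulli q).real (G e)) ^ (j e) * (1 - (prodBernoulli q).real (G e)) ^ (k - j e)) := fun e =>
    ((combPos_real_gadget π hG e).pow (j e)).mul ((combPos_one_sub_real_gadget π hG e).pow (k - j e))
  refine (SahiComb.CombPos.prod univ fun e _ => hterm e).mono fun i => ?_
  have hji : j (π i) ≤ k := mem_box.1 hj (π i)
  simp only [Finset.sum_apply, Pi.add_apply, Pi.smul_apply, smul_eq_mul, hδ, Finset.mem_filter, Finset.mem_univ, true_and]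
  rw [Finset.sum_eq_single (π i)]
  · simp only [ne_eq, not_true_eq_false, if_false, mul_one]; omega
  · intro e _ he; simp [Ne.symm he]
  · intro h; exact absurd (mem_univ _) h

/-- **COMB POSITIVITY IS CLOSED UNDER READ-ONCE MONOTONE SUBSTITUTION** (every `k`): if `p ↦ E_k(μ_p; 1_{U_0},…,1_{U_{k-1}})` is comb-positive at multidegree `k` on
`[0,1]^κ`, then for gadgets `G e` determined by the disjoint fibres of `π : ι → κ`, `q ↦ E_k(μ_q; 1_{U_0∘G},…,1_{U_{k-1}∘G})` is comb-positive at multidegree `k` on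
`[0,1]^ι`. [this work] -/
theorem CombPos.readOnce (π : ι → κ) (G : κ → Set (Set ι)) (hG : ∀ e, DeterminedBy (G e) {i | π i = e}) {k : ℕ} {U : Fin k → Set (Set κ)}
    (hU : CombPos (fun _ : κ => k) (fun p => sahiE (bernoulliWeight p) k (fun j => ind (U j)))) :
    CombPos (fun _ : ι => k) (fun q => sahiE (bernoulliWeight q) k (fun j => ind {ω : Set ι | {e | ω ∈ G e} ∈ U j})) := by
  obtain ⟨N, hN, hrep⟩ := hU
  have key : ∀ q : ι → unitInterval, sahiE (bernoulliWeight q) k (fun j => ind {ω : Set ι | {e | ω ∈ G e} ∈ U j}) =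
      ∑ j ∈ box (fun _ : κ => k), N j * ∏ e, ((prodBernoulli q).real (G e)) ^ (j e) * (1 - (prodBernoulli q).real (G e)) ^ (k - j e) := by
    intro q
    let c : κ → unitInterval := fun e => ⟨(prodBernoulli q).real (G e), measureReal_nonneg, measureReal_le_one⟩
    have hw : (weight fun e => (prodBernoulli q).real (G e)) = bernoulliWeight c := rfl
    have hc := hrep c
    dsimp only at hc
    rw [sahiE_readOnce_eq π G hG q U, hw, hc]
    rfl
  refine (CombPos.sum (box (fun _ : κ => k)) fun j hj => ((combPos_bern_gadget π hG k hj).smul (hN j))).congr key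

/-- Bookkeeping form: **(M⁺-k) implies its own read-once closure** — GIVEN `MasterFamilyCombPos k`, every family of read-once substitutions of increasing gadgets into
increasing events is comb-positive. (Of course (M⁺-k) applied on `ι` gives this directly; the content of `CombPos.readOnce` is the UNCONDITIONAL transfer of proved rows.)
[this work] -/
theorem masterFamilyCombPos_readOnce {k : ℕ} (hN : MasterFamilyCombPos k) (π : ι → κ) (G : κ → Set (Set ι))
    (hG : ∀ e, DeterminedBy (G e) {i | π i = e}) (U : Fin k → Set (Set κ)) (hU : ∀ j, IsUpperSet (U j)) :
    CombPos (fun _ : ι => k) (fun q => sahiE (bernoulliWeight q) k (fun j => ind {ω : Set ι | {e | ω ∈ G e} ∈ U j})) :=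
  CombPos.readOnce π G hG (hN κ U hU)

/-! ### Unconditional corollaries -/

/-- **Monomials in independent increasing events are comb-positive at every order**: for gadgets `G e` determined by the disjoint fibres of `π` and index sets
`S_j ⊆ κ`, `q ↦ E_n(μ_q; 1_{⋂_{e∈S_0} G e}, …, 1_{⋂_{e∈S_{n-1}} G e})` is comb-positive at multidegree `n` (comb form of Sahi's Theorem 2 with coordinates replaced by
independent events; `combPos_sahiE_ind_of_cylinders` + `CombPos.readOnce`).  The gadgets need not be increasing. [this work] -/
theorem combPos_sahiE_ind_monomials (π : ι → κ) (G : κ → Set (Set ι)) (hG : ∀ e, DeterminedBy (G e) {i | π i = e}) {n : ℕ}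
    (S : Fin n → Set κ) :
    CombPos (fun _ : ι => n) (fun q => sahiE (bernoulliWeight q) n (fun j => ind (⋂ e ∈ S j, G e))) := by
  have h := CombPos.readOnce π G hG (combPos_sahiE_ind_of_cylinders (ι := κ) S)
  refine h.congr fun q => ?_
  congr 1; funext j; rw [← readOnce_cylinder G (S j)]

/-- Law-level shadow: `E_n(μ_q) ≥ 0` on monomials in independent events. [this work] -/
theorem sahiE_ind_nonneg_monomials (q : ι → unitInterval) (π : ι → κ) (G : κ → Set (Set ι))
    (hG : ∀ e, DeterminedBy (G e) {i | π i = e}) {n : ℕ} (S : Fin n → Set κ) :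
    0 ≤ sahiE (bernoulliWeight q) n (fun j => ind (⋂ e ∈ S j, G e)) :=
  (combPos_sahiE_ind_monomials π G hG S).nonneg q

/-- **Monomials plus at most two arbitrary members of the gadget algebra**: if all but at most two of the increasing base events `U_j ⊆ 2^κ` are cylinders, the substituted
family is comb-positive at every order (`combPos_sahiE_ind_of_allButTwoCylinders` + `CombPos.readOnce`). [this work] -/
theorem combPos_sahiE_ind_readOnce_offTwo (π : ι → κ) (G : κ → Set (Set ι)) (hG : ∀ e, DeterminedBy (G e) {i | π i = e}) {n : ℕ}
    (U : Fin n → Set (Set κ)) (hU : ∀ j, IsUpperSet (U j))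
    (hE : ∃ E : Finset (Fin n), E.card ≤ 2 ∧ ∀ j, j ∉ E → ∃ S : Set κ, U j = {ξ : Set κ | S ⊆ ξ}) :
    CombPos (fun _ : ι => n) (fun q => sahiE (bernoulliWeight q) n (fun j => ind {ω : Set ι | {e | ω ∈ G e} ∈ U j})) :=
  CombPos.readOnce π G hG (combPos_sahiE_ind_of_allButTwoCylinders n U hU hE)

/-- **(M⁺-3) on the monotone algebra generated by THREE independent increasing events**: for `κ` with at most three elements (kernel certificate
`SahiC3CombCube.combPos_sahiE_three_of_card_le_three`) and any increasing `U, V, W ⊆ 2^κ`, the triple of substituted events is comb-positive at multidegree `3` on every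
cube `ι`. [this work] -/
theorem combPos_sahiE_three_readOnce_three (hκ : Fintype.card κ ≤ 3) (π : ι → κ) (G : κ → Set (Set ι))
    (hG : ∀ e, DeterminedBy (G e) {i | π i = e}) {U V W : Set (Set κ)} (hU : IsUpperSet U) (hV : IsUpperSet V) (hW : IsUpperSet W) :
    CombPos (fun _ : ι => 3) (fun q => sahiE (bernoulliWeight q) 3
      ![ind {ω : Set ι | {e | ω ∈ G e} ∈ U}, ind {ω : Set ι | {e | ω ∈ G e} ∈ V}, ind {ω : Set ι | {e | ω ∈ G e} ∈ W}]) := by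
  have h0 : CombPos (fun _ : κ => 3) (fun p => sahiE (bernoulliWeight p) 3 (fun j => ind (![U, V, W] j))) := by
    refine (SahiC3CombCube.combPos_sahiE_three_of_card_le_three hκ hU hV hW).congr fun p => ?_
    congr 1; funext j; fin_cases j <;> rfl
  refine (CombPos.readOnce π G hG h0).congr fun q => ?_
  congr 1; funext j; fin_cases j <;> rfl

/-- Law-level shadow: Sahi's `E_3 ≥ 0` (Kahn's Conjecture 5 instance) for every triple of increasing events in the monotone algebra generated by three independent
increasing events of a finite cube, every product measure. [this work] -/
theorem sahiE_three_nonneg_readOnce_three (q : ι → unitInterval) (hκ : Fintype.card κ ≤ 3) (π : ι → κ) (G : κ → Set (Set ι))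
    (hG : ∀ e, DeterminedBy (G e) {i | π i = e}) {U V W : Set (Set κ)} (hU : IsUpperSet U) (hV : IsUpperSet V) (hW : IsUpperSet W) :
    0 ≤ sahiE (bernoulliWeight q) 3
      ![ind {ω : Set ι | {e | ω ∈ G e} ∈ U}, ind {ω : Set ι | {e | ω ∈ G e} ∈ V}, ind {ω : Set ι | {e | ω ∈ G e} ∈ W}] :=
  (combPos_sahiE_three_readOnce_three hκ π G hG hU hV hW).nonneg q

end SahiCombReadOnce

end Summit.CriticalPhenomena.PercolationContinuityZ3.Theorems

end
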